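import Summits.KontsevichZagierPeriods.KontsevichZagierPeriods.Theses.CoactionDevissage
import Literature.NumberTheory.Transcendental.MZVSimplexRepProofs

/-!
# `SectorAssembly` (stmt-KontsevichZagierPeriods-3174, route CoactionDevissage) — proof

Statement: write `ρ u := [KZ.mzvRep u]` (the class of Kontsevich's simplex representation of `ζ(u)`)
for admissible `u` and `ρ u := 0` otherwise. Assume
* `HoffmanSpan`: for every admissible `s` there are `N ≠ 0` and a finite list of Hoffman indices
  `tᵢ ∈ {2,3}^×` with integer coefficients `bᵢ` such that `N • ρ s − Σᵢ bᵢ • ρ tᵢ ∈ KZ.relations`;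
* `TorsionFree`: `n ≠ 0`, `n • c ∈ KZ.relations ⇒ c ∈ KZ.relations`;
* the real Hoffman values `ζ(t)`, `t ∈ {2,3}^×`, are `ℚ`-linearly independent.
Then every `c` in the subgroup of `KZ.FormalRep` generated by the `ρ u` with `KZ.eval c = 0` lies in
`KZ.relations` (the MZV-sector form of the Kontsevich–Zagier period conjecture, with its transcendence
input isolated as the third hypothesis).

Proof (pure algebra). By induction over the generated subgroup, every such `c` has a *Hoffman normal
form*: some `N ≠ 0` and a finitely supported integer vector `a` on the Hoffman indices with
`N • c − Σ_t a(t) • ρ t ∈ KZ.relations` (generators: `HoffmanSpan`, collecting the list into a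
`Finsupp` so that equal indices are merged; sums: take the product of the two multipliers; negation).
If `KZ.eval c = 0`, soundness of the calculus (`KZ.relations_le_ker_eval_holds`) and Kontsevich's
formula `KZ.eval (ρ t) = ζ(t)` (`KZ.mzvRep_value_holds`) turn the normal form into a vanishing
rational combination `Σ_t a(t) ζ(t) = 0` of DISTINCT Hoffman values, so `a = 0` by independence; hence
`N • c ∈ KZ.relations`, and `c ∈ KZ.relations` by `TorsionFree`.

References: F. Brown, *Mixed Tate motives over ℤ*, Ann. of Math. 175 (2012), Thm 1.1; D. Zagier,
*Values of zeta functions and their applications*, ECM 1992 (1994), §9; M. Kontsevich, D. Zagier,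
*Periods* (2001), §1.2.
-/

namespace Summit.KontsevichZagierPeriods.CoactionDevissage

open Literature.NumberTheory.Transcendental

namespace SectorAssembly

/-- A finite list of (Hoffman index, integer coefficient) pairs is collected into a finitely supported
integer vector on the Hoffman indices with the same linear combination of the `ρ t` (equal indices
are merged by additivity of `Finsupp.linearCombination`). [folklore] -/
theorem exists_finsupp_of_list (ρ : List ℕ → KZ.FormalRep) (L : List (List ℕ × ℤ))
    (hL : ∀ p ∈ L, MZV.IsHoffman p.1) :
    ∃ a : {s : List ℕ // MZV.IsHoffman s} →₀ ℤ,
      Finsupp.linearCombination ℤ (fun j : {s : List ℕ // MZV.IsHoffman s} => ρ j.1) a =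
        (L.map fun p => p.2 • ρ p.1).sum := by
  induction L with
  | nil => exact ⟨0, by simp⟩
  | cons p L ih =>
    obtain ⟨a, ha⟩ := ih fun q hq => hL q (List.mem_cons_of_mem p hq)
    refine ⟨Finsupp.single ⟨p.1, hL p List.mem_cons_self⟩ p.2 + a, ?_⟩
    rw [map_add, Finsupp.linearCombination_single, ha, List.map_cons, List.sum_cons]

/-- **Hoffman normal form on the generated subgroup.** If `ρ` vanishes off the admissible indices and
every admissible `ρ s` has a Hoffman normal form (`HoffmanSpan`), then every element `c` of the subgroup
generated by the `ρ u` has one: `N ≠ 0` and an integer vector `a` on the Hoffman indices with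
`N • c − Σ_t a(t) • ρ t ∈ KZ.relations`. Closure induction; for a sum take the product of the two
multipliers, `N₁N₂ • (x + y) − Σ (N₂a₁ + N₁a₂) = N₂ • (N₁ • x − Σ a₁) + N₁ • (N₂ • y − Σ a₂)`. [folklore] -/
theorem exists_normalForm (ρ : List ℕ → KZ.FormalRep)
    (hρ0 : ∀ u, ¬ MZV.IsAdmissible u → ρ u = 0)
    (hS : ∀ s : List ℕ, MZV.IsAdmissible s → ∃ (N : ℕ) (L : List (List ℕ × ℤ)), N ≠ 0 ∧
      (∀ p ∈ L, MZV.IsHoffman p.1 ∧ MZV.weight p.1 = MZV.weight s) ∧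
      N • ρ s - (L.map fun p => p.2 • ρ p.1).sum ∈ KZ.relations)
    (c : KZ.FormalRep) (hc : c ∈ AddSubgroup.closure (Set.range ρ)) :
    ∃ (N : ℕ) (a : {s : List ℕ // MZV.IsHoffman s} →₀ ℤ), N ≠ 0 ∧
      N • c - Finsupp.linearCombination ℤ (fun j : {s : List ℕ // MZV.IsHoffman s} => ρ j.1) a ∈
        KZ.relations := by
  induction hc using AddSubgroup.closure_induction with
  | mem x hx =>
    obtain ⟨u, rfl⟩ := hx
    by_cases hu : MZV.IsAdmissible u
    · obtain ⟨N, L, hN, hL, hrel⟩ := hS u hu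
      obtain ⟨a, ha⟩ := exists_finsupp_of_list ρ L fun p hp => (hL p hp).1
      exact ⟨N, a, hN, by rwa [ha]⟩
    · refine ⟨1, 0, one_ne_zero, ?_⟩
      rw [hρ0 u hu, map_zero, smul_zero, sub_zero]
      exact zero_mem _
  | zero =>
    refine ⟨1, 0, one_ne_zero, ?_⟩
    rw [map_zero, smul_zero, sub_zero]
    exact zero_mem _
  | add x y _ _ ihx ihy =>
    obtain ⟨N₁, a₁, hN₁, h₁⟩ := ihx
    obtain ⟨N₂, a₂, hN₂, h₂⟩ := ihy
    refine ⟨N₁ * N₂, N₂ • a₁ + N₁ • a₂, mul_ne_zero hN₁ hN₂, ?_⟩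
    have key : (N₁ * N₂) • (x + y) -
        Finsupp.linearCombination ℤ (fun j : {s : List ℕ // MZV.IsHoffman s} => ρ j.1)
          (N₂ • a₁ + N₁ • a₂) =
        N₂ • (N₁ • x - Finsupp.linearCombination ℤ
          (fun j : {s : List ℕ // MZV.IsHoffman s} => ρ j.1) a₁) +
        N₁ • (N₂ • y - Finsupp.linearCombination ℤ
          (fun j : {s : List ℕ // MZV.IsHoffman s} => ρ j.1) a₂) := by
      rw [map_add, map_nsmul, map_nsmul]
      module
    rw [key]
    exact add_mem (AddSubgroup.nsmul_mem _ h₁ N₂) (AddSubgroup.nsmul_mem _ h₂ N₁)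
  | neg x _ ih =>
    obtain ⟨N, a, hN, h⟩ := ih
    refine ⟨N, -a, hN, ?_⟩
    have key : N • (-x) -
        Finsupp.linearCombination ℤ (fun j : {s : List ℕ // MZV.IsHoffman s} => ρ j.1) (-a) =
        -(N • x - Finsupp.linearCombination ℤ
          (fun j : {s : List ℕ // MZV.IsHoffman s} => ρ j.1) a) := by
      rw [map_neg, smul_neg]
      abel
    rw [key]
    exact neg_mem h

/-- **Evaluation of a Hoffman combination** by Kontsevich's formula: if `ρ t = [KZ.mzvRep t]` on
admissible `t`, then `KZ.eval (Σ_t a(t) • ρ t) = Σ_t a(t) ζ(t)` (Hoffman indices are admissible;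
`KZ.mzvRep_value_holds`). [cite: KontsevichZagier2001, §1.1] -/
theorem eval_linearCombination (ρ : List ℕ → KZ.FormalRep)
    (hρ : ∀ (u : List ℕ) (hu : MZV.IsAdmissible u), ρ u = KZ.of (KZ.mzvRep u hu
      (KZ.mzvIntegrand_isSemialgebraicFunOn_holds u) (KZ.mzvIntegrand_integrableOn_holds u hu)))
    (a : {s : List ℕ // MZV.IsHoffman s} →₀ ℤ) :
    KZ.eval (Finsupp.linearCombination ℤ (fun j : {s : List ℕ // MZV.IsHoffman s} => ρ j.1) a) =
      a.sum fun j k => (k : ℝ) * multipleZeta j.1 := by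
  rw [Finsupp.linearCombination_apply, map_finsuppSum]
  refine Finsupp.sum_congr fun j _ => ?_
  rw [map_zsmul, hρ j.1 j.2.isAdmissible, KZ.eval_of, KZ.mzvRep_value_holds, zsmul_eq_mul]

/-- **Independence kills the coefficients**: if the real Hoffman values are `ℚ`-linearly independent
and an integer combination `Σ_t a(t) ζ(t)` over distinct Hoffman indices vanishes, then `a = 0`
(pass to the rational vector `t ↦ (a(t) : ℚ)` and apply `linearIndependent_iff`). [folklore] -/
theorem finsupp_eq_zero_of_sum_eq_zero
    (hind : LinearIndependent ℚ
      (fun s : {s : List ℕ // MZV.IsHoffman s} => multipleZeta s.1))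
    (a : {s : List ℕ // MZV.IsHoffman s} →₀ ℤ)
    (h : (a.sum fun j k => (k : ℝ) * multipleZeta j.1) = 0) : a = 0 := by
  set b : {s : List ℕ // MZV.IsHoffman s} →₀ ℚ := a.mapRange (Int.cast) Int.cast_zero with hb
  have hb0 : Finsupp.linearCombination ℚ
      (fun s : {s : List ℕ // MZV.IsHoffman s} => multipleZeta s.1) b = 0 := by
    rw [Finsupp.linearCombination_apply, hb, Finsupp.sum_mapRange_index]
    · rw [← h]
      exact Finsupp.sum_congr fun j _ => by rw [Rat.smul_def, Rat.cast_intCast]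
    · exact fun j => zero_smul _ _
  have hb1 : b = 0 := linearIndependent_iff.mp hind b hb0
  ext j
  have := DFunLike.congr_fun hb1 j
  simpa [hb] using this

/-- **The sector theorem for a pinned assignment.** For any `ρ` agreeing with `[KZ.mzvRep u]` on
admissible `u` and vanishing elsewhere: Hoffman spanning inside the calculus, torsion-freeness of
`P_KZ` and `ℚ`-linear independence of the real Hoffman values imply that every `c` in the subgroup
generated by the `ρ u` with `KZ.eval c = 0` is a relation. Proof: Hoffman normal form
`N • c ≡ Σ a(t) • ρ t`; evaluate (soundness `KZ.relations_le_ker_eval_holds`, Kontsevich's formula)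
to get `Σ a(t) ζ(t) = 0`; independence gives `a = 0`; so `N • c ∈ KZ.relations` and `TorsionFree`
divides by `N`. [cite: Brown2012, Thm 1.1] -/
theorem mem_relations_of_eval_eq_zero (ρ : List ℕ → KZ.FormalRep)
    (hρ : ∀ (u : List ℕ) (hu : MZV.IsAdmissible u), ρ u = KZ.of (KZ.mzvRep u hu
      (KZ.mzvIntegrand_isSemialgebraicFunOn_holds u) (KZ.mzvIntegrand_integrableOn_holds u hu)))
    (hρ0 : ∀ u, ¬ MZV.IsAdmissible u → ρ u = 0)
    (hS : ∀ s : List ℕ, MZV.IsAdmissible s → ∃ (N : ℕ) (L : List (List ℕ × ℤ)), N ≠ 0 ∧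
      (∀ p ∈ L, MZV.IsHoffman p.1 ∧ MZV.weight p.1 = MZV.weight s) ∧
      N • ρ s - (L.map fun p => p.2 • ρ p.1).sum ∈ KZ.relations)
    (hT : Summit.KontsevichZagierPeriods.KontsevichZagierPeriods.Theses.CoactionDevissage.TorsionFree)
    (hind : LinearIndependent ℚ
      (fun s : {s : List ℕ // MZV.IsHoffman s} => multipleZeta s.1))
    (c : KZ.FormalRep) (hc : c ∈ AddSubgroup.closure (Set.range ρ)) (hc0 : KZ.eval c = 0) :
    c ∈ KZ.relations := by
  obtain ⟨N, a, hN, hrel⟩ := exists_normalForm ρ hρ0 hS c hc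
  have h1 : KZ.eval (N • c -
      Finsupp.linearCombination ℤ (fun j : {s : List ℕ // MZV.IsHoffman s} => ρ j.1) a) = 0 :=
    (AddMonoidHom.mem_ker).1 (KZ.relations_le_ker_eval_holds hrel)
  rw [map_sub, map_nsmul, hc0, smul_zero, zero_sub, neg_eq_zero, eval_linearCombination ρ hρ] at h1
  have ha : a = 0 := finsupp_eq_zero_of_sum_eq_zero hind a h1
  rw [ha, map_zero, sub_zero] at hrel
  exact hT N c hN hrel

end SectorAssembly

/-- **`SectorAssembly`** (route CoactionDevissage, stmt-KontsevichZagierPeriods-3174):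
`HoffmanSpan → TorsionFree → (ℚ-linear independence of the real Hoffman values ζ(t), t ∈ {2,3}^×) →`
every `c` in the subgroup generated by the simplex classes `ρ u = [KZ.mzvRep u]` with `KZ.eval c = 0`
lies in `KZ.relations`. Proof: the route's `ρ` is pinned to `[KZ.mzvRep u]` on admissible `u`
(`dif_pos`) and is `0` elsewhere (`dif_neg`), so this is `SectorAssembly.mem_relations_of_eval_eq_zero`
(Hoffman normal form by closure induction with a common multiplier, soundness + Kontsevich's formula,
independence, torsion-freeness). [cite: Brown2012, Thm 1.1] -/
theorem sectorAssembly_proof :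
    Summit.KontsevichZagierPeriods.KontsevichZagierPeriods.Theses.CoactionDevissage.SectorAssembly := by
  intro hS hT hind c hc hc0
  -- the route's assignment `ρ`, written out
  exact SectorAssembly.mem_relations_of_eval_eq_zero
    (fun u => if h : MZV.IsAdmissible u then KZ.of (KZ.mzvRep u h
      (KZ.mzvIntegrand_isSemialgebraicFunOn_holds u) (KZ.mzvIntegrand_integrableOn_holds u h)) else 0)
    (fun u hu => dif_pos hu) (fun u hu => dif_neg hu) hS hT hind c hc hc0

end Summit.KontsevichZagierPeriods.CoactionDevissage
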